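import Literature.Analysis.FluidPDE.Seregin2020ScaledEnergyBoundsE
import Literature.Analysis.FluidPDE.LocalTypeIPersistenceHolds
import HarnessLib

/-!
# Seregin 2020, proof of Theorem 2.1: ε-regularity at the vertex and the non-triviality bound
# `C(r) ≥ ε(L₀)` at a singular point with bounded scaled pressure ((2.9))

Analysis/FluidPDE proof file (everything proved; no definitions, no named facts) on the way to
the named fact `Literature.Analysis.FluidPDE.Seregin2020_axisymmetricSingularPoint_typeII`
(`Seregin2020AxisymmetricTypeII.lean`; G. Seregin, *Local regularity of axisymmetric solutions to
the Navier–Stokes equations*, Anal. Math. Phys. 10 (2020), Paper 46 = arXiv:2006.04140, Thm. 2.1).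

After the reduction `g(0) < ∞ ⇒ L₀ = sup_{0<r<1} (A + C + E + D)(r) < ∞` ((2.7)–(2.8);
`Seregin2020.typeI_scaledEnergies_bounded`), the printed proof rescales `v` at the origin,
`uᵏ(y, s) = λₖ v(λₖ y, λₖ² s)`, `λₖ → 0`, and records about the limit `u` that "the velocity `u` is
not trivial in the sense `a⁻² ∫_{Q(a)} |u|³ dz ≥ ε(L₀) > 0` for all `0 < a ≤ 1`, see also
[Seregin2016]" ((2.9)). Since `C(uᵏ; a) = C(v; λₖ a)` (scale invariance) and `C` passes to strong
`L³` limits, (2.9) is the following statement about `v` itself, proved in this file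
(`Seregin2020.exists_le_cknC_of_isBackwardSingularPoint`):

> if `z` is a (backward) singular point of a suitable weak solution `(v, q)` on `Q ⊇ Q_{r₀}(z)`
> and `D(q; r) ≤ L` for `0 < r ≤ r₀`, then `C(v; r) ≥ κ(L) > 0` for all `0 < r ≤ r₀`, with `κ`
> depending only on `L`.

The mechanism is the one behind Prop. 1.4 (1) of the paper (the one-scale ε-regularity
criterion, Caffarelli–Kohn–Nirenberg 1982, Prop. 1; in tree Robinson–Rodrigo–Sadowski 2016,
Thm. 15.3, `RRS2016.theorem15_3_holds`, transported by scaling in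
`unforced_epsilonRegularity_of_theorem15_3`) combined with the pressure decay estimate
`D(θr) ≤ c (θ D(r) + θ⁻² C(r))` (Seregin–Šverák 2009, (as13); `seregin_sverak_pressure_decay_holds`):
if `C(r) < κ` then `C(θr) + D(θr) ≤ cθL + (c + 1)θ⁻²κ ≤ ε₀³` for `θ = θ(L)` small and
`κ = ε₀³θ²/(4(c+1))`, so `v` is bounded on `Q_{θr/2}(z)` — impossible at a singular point. This is
exactly the argument of the tree's proof of Albritton–Barker's Prop. 2.3
(`PersistenceOfSingularities_of_unforced`, `LocalTypeIPersistence.lean`), here at a fixed solution.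

As in the companion files, the one technical point is that the vertex `z` of the cylinders lies
on the top of the domain (`Q_r(z) ⊆ Q`, open inclusion, never `closure Q_r(z) ⊆ Q`): the
ε-regularity criterion is therefore applied in Lemarié-Rieusset's shape on the domain
`Ω = Q_{r₀}(z)` itself, whose §14.3 global classes are supplied by the finiteness of
`A(r₀)`, `E(r₀)`, `D(r₀)` (`Seregin2020.exists_isLRSuitableWeakSolutionOn_of_finite`).

## Contents (namespace `Literature.Analysis.FluidPDE.Seregin2020`)

* `exists_isLRSuitableWeakSolutionOn_of_finite` — §14.3 classes on a top-touching cylinder from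
  `A(r₀), E(r₀), D(r₀) < ∞`;
* `exists_epsilonRegularity_top` — Prop. 1.4 (1) of the paper at cylinders `Q_r(z) ⊆ Q_{r₀}(z) ⊆ Q`
  touching the top: `C(r) + D(r) ≤ λ³`, `λ ≤ ε₀` gives `|u| ≤ C₀ λ / r` a.e. on `Q_{r/2}(z)`;
* `exists_le_cknC_of_isBackwardSingularPoint` — the bound `C(r) ≥ κ(L)` above ((2.9) for `v`);
* `le_cknC_of_tendsto_eLpNorm` — lower bounds of `C` pass to strong `L³` limits (the passage
  from `v` to the blow-up limit `u` in (2.9));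
* `typeI_singular_scaledEnergies` — (2.8) and (2.9) together in the setting of Thm. 2.1: under
  its hypotheses and the Type I assumption `g(0) < ∞`, on some `]0, r₁]` the four scaled energies
  are bounded by `K` and the cubic one is bounded below by `κ > 0`.

## Mathlib / tree search

Tree (all used): `unforced_epsilonRegularity_of_theorem15_3`, `RRS2016.theorem15_3_holds`,
`seregin_sverak_pressure_decay_holds(.ratio)`, `setLIntegral_cubic_add_pressure_le_of_cknC_add_cknD_le`,
`RRS2016.ae_ball_sq_le_of_cknAEss_le`, `ae_lintegral_indicator_parabolicCylinder_le`,
`HasWeakSpatialGradientOn.ae_eq`, `cknC_le_mul_of_subset`, `cknC_le_of_tendsto_eLpNorm` (the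
upper-bound twin of `le_cknC_of_tendsto_eLpNorm`, `LocalTypeILscVelocity.lean`).
`lean search 'le_cknC_of\|cknC_lower\|nontrivial.*cknC'`: nothing of this kind in tree.

## References

* G. Seregin, Anal. Math. Phys. 10 (2020), Paper 46 = arXiv:2006.04140, Prop. 1.4 (1) and the
  proof of Thm. 2.1, (2.9). [Seregin2020]
* G. Seregin, *Remark on Wolf's condition for boundary regularity of Navier–Stokes equations*,
  Zap. Nauchn. Sem. POMI 444 (2016), 124–132 (cited in loc. cit. for (2.9)). [Seregin2016]
* G. Seregin, V. Šverák, Comm. PDE 34 (2009) = arXiv:0804.1803, (as13). [SereginSverak2009]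
* J. C. Robinson, J. L. Rodrigo, W. Sadowski, *The three-dimensional Navier–Stokes equations*,
  CUP 2016, Thm. 15.3–15.4. [RobinsonRodrigoSadowski2016]
* L. Caffarelli, R. Kohn, L. Nirenberg, CPAM 35 (1982), Prop. 1. [CaffarelliKohnNirenberg1982]
-/

noncomputable section

open MeasureTheory Set Function Filter Topology TopologicalSpace Metric
open scoped NNReal ENNReal

namespace Literature.Analysis.FluidPDE

namespace Seregin2020

/-! ### The §14.3 classes on a cylinder touching the top of the domain -/

/-- **Lemarié-Rieusset's §14.3 hypotheses on a top-touching cylinder.** Let `(u, p)` be a suitable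
weak solution of the unforced Navier–Stokes equations (`ν = 1`) on an open `Q`, `G` a weak spatial
gradient of `u` on `Q`, and `Q_{r₀}(z) ⊆ Q` (open inclusion) with `A(r₀; z), E(r₀; z), D(r₀; z) < ∞`
(`A = cknAEss`, `E = cknE`, `D = cknD`). Then on the domain `Ω = Q_{r₀}(z)` the pair satisfies
`IsLRSuitableWeakSolutionOn Ω 1 q 0 u p G'` for the gradient `G'` of the local energy inequality
(which agrees with `G` a.e.) and any force exponent `q`: the three finiteness hypotheses are the
global classes `u ∈ L^∞_t L²_x(Ω)`, `∇u ∈ L²(Ω)`, `p ∈ L^{3/2}(Ω)`. [folklore] -/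
theorem exists_isLRSuitableWeakSolutionOn_of_finite {Q : Opens (ℝ × EuclideanSpace ℝ (Fin 3))}
    {u : ℝ → EuclideanSpace ℝ (Fin 3) → EuclideanSpace ℝ (Fin 3)}
    {p : ℝ → EuclideanSpace ℝ (Fin 3) → ℝ}
    {G : ℝ → EuclideanSpace ℝ (Fin 3) → EuclideanSpace ℝ (Fin 3) →L[ℝ] EuclideanSpace ℝ (Fin 3)}
    (hsw : IsSuitableWeakSolutionOn Q 1 0 u p) (hG : HasWeakSpatialGradientOn Q u G)
    {z : ℝ × EuclideanSpace ℝ (Fin 3)} {r₀ : ℝ} (hr₀ : 0 < r₀)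
    (hQ : parabolicCylinder r₀ z ⊆ (Q : Set (ℝ × EuclideanSpace ℝ (Fin 3))))
    (hA₀ : cknAEss r₀ z u ≠ ∞) (hE₀ : cknE r₀ z G ≠ ∞) (hD₀ : cknD r₀ z p ≠ ∞) (q : ℝ) :
    ∃ G' : ℝ → EuclideanSpace ℝ (Fin 3) → EuclideanSpace ℝ (Fin 3) →L[ℝ] EuclideanSpace ℝ (Fin 3),
      IsLRSuitableWeakSolutionOn (parabolicCylinderOpens r₀ z) 1 q 0 u p G' := by
  obtain ⟨G', hG', -, hLEI⟩ := hsw.localEnergy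
  set Ω : Opens (ℝ × EuclideanSpace ℝ (Fin 3)) := parabolicCylinderOpens r₀ z with hΩdef
  have hΩ : (Ω : Set (ℝ × EuclideanSpace ℝ (Fin 3))) = parabolicCylinder r₀ z := rfl
  have hle : Ω ≤ Q := fun w hw => hQ hw
  have hr0 : (ENNReal.ofReal r₀) ≠ 0 := (ENNReal.ofReal_pos.2 hr₀).ne'
  -- ### the energy class from `A(r₀) < ∞`
  have hEn : ∃ C : ℝ≥0, ∀ᵐ t : ℝ,
      ∫⁻ x, (Ω : Set (ℝ × EuclideanSpace ℝ (Fin 3))).indicator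
        (fun w : ℝ × EuclideanSpace ℝ (Fin 3) => ‖u w.1 w.2‖ₑ ^ 2) (t, x) ≤ C := by
    set M : ℝ := (cknAEss r₀ z u).toReal / r₀ ^ 2 with hM
    have hM0 : 0 ≤ M := div_nonneg ENNReal.toReal_nonneg (sq_nonneg _)
    have hle' : cknAEss r₀ z u ≤ ENNReal.ofReal (M * r₀ ^ 2) := by
      rw [hM, div_mul_cancel₀ _ (pow_ne_zero _ hr₀.ne'), ENNReal.ofReal_toReal hA₀]
    have h1 := RRS2016.ae_ball_sq_le_of_cknAEss_le hr₀ hle'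
    refine ⟨(M * r₀ ^ 3).toNNReal, ?_⟩
    have h2 : ∀ᵐ t ∂(volume.restrict (Ioo (z.1 - r₀ ^ 2) z.1)),
        ∫⁻ x in ball z.2 r₀, ‖u t x‖ₑ ^ 2 ≤ ENNReal.ofReal (M * r₀ ^ 3) := by
      rw [ae_restrict_iff' measurableSet_Ioo]
      exact h1
    have h3 := ae_lintegral_indicator_parabolicCylinder_le h2
    rw [hΩ]
    exact h3
  -- ### `∇u ∈ L²(Ω)` from `E(r₀) < ∞` (the two gradients agree a.e.)
  have hGr : ∫⁻ w in (Ω : Set (ℝ × EuclideanSpace ℝ (Fin 3))),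
      ENNReal.ofReal (frobeniusNormSq (G' w.1 w.2)) < ∞ := by
    have hae : ∀ᵐ w ∂(volume.restrict (parabolicCylinder r₀ z)),
        uncurry G' w = uncurry G w :=
      ae_restrict_of_ae_restrict_of_subset hQ (hG'.ae_eq hG)
    have e : ∫⁻ w in parabolicCylinder r₀ z, ENNReal.ofReal (frobeniusNormSq (G' w.1 w.2)) =
        ∫⁻ w in parabolicCylinder r₀ z, ENNReal.ofReal (frobeniusNormSq (G w.1 w.2)) := by
      refine lintegral_congr_ae ?_
      filter_upwards [hae] with w hw
      change ENNReal.ofReal (frobeniusNormSq (uncurry G' w)) =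
        ENNReal.ofReal (frobeniusNormSq (uncurry G w))
      rw [hw]
    have hfin : ∫⁻ w in parabolicCylinder r₀ z, ENNReal.ofReal (frobeniusNormSq (G w.1 w.2)) ≠ ∞ := by
      intro htop
      apply hE₀
      rw [cknE, htop, ENNReal.mul_top (ENNReal.inv_ne_zero.2 ENNReal.ofReal_ne_top)]
    rw [hΩ, e]
    exact hfin.lt_top
  -- ### `p ∈ L^{3/2}(Ω)` from `D(r₀) < ∞`
  have hPr : ∫⁻ w in (Ω : Set (ℝ × EuclideanSpace ℝ (Fin 3))), ‖p w.1 w.2‖ₑ ^ (3 / 2 : ℝ) < ∞ := by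
    have hfin : ∫⁻ w in parabolicCylinder r₀ z, ‖p w.1 w.2‖ₑ ^ (3 / 2 : ℝ) ≠ ∞ := by
      intro htop
      apply hD₀
      rw [cknD, htop, ENNReal.mul_top]
      exact ENNReal.inv_ne_zero.2 (ENNReal.pow_ne_top ENNReal.ofReal_ne_top)
    rw [hΩ]
    exact hfin.lt_top
  refine ⟨G',
    { isConnected := ?_
      energyClass := hEn
      weakGradient := hG'.mono hle
      gradient_lt_top := hGr
      pressure_lt_top := hPr
      force_memLp := by rw [uncurry_zero]; exact MemLp.zero
      distributional := hsw.distributional.of_le hle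
      localEnergy := fun φ hφ hφ0 => hLEI φ (hφ.mono hle) hφ0 }⟩
  rw [hΩ]
  refine ⟨⟨(z.1 - r₀ ^ 2 / 2, z.2), ?_⟩, ((convex_Ioo _ _).prod (convex_ball _ _)).isPreconnected⟩
  rw [mem_parabolicCylinder, dist_self]
  exact ⟨⟨by nlinarith, by nlinarith⟩, hr₀⟩

/-! ### Prop. 1.4 (1): the one-scale ε-regularity criterion at cylinders touching the top -/

/-- **Seregin 2020, Prop. 1.4 (1), at cylinders touching the top of the domain** (the one-scale
ε-regularity criterion of Caffarelli–Kohn–Nirenberg 1982, Prop. 1, in the quantitative form of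
Robinson–Rodrigo–Sadowski 2016, Thm. 15.3/15.4). There are absolute `ε₀, C₀ > 0` such that: if
`(u, p)` is a suitable weak solution (`ν = 1`, no force) on an open `Q`, `G` a weak spatial
gradient of `u` on `Q`, `Q_{r₀}(z) ⊆ Q` (open inclusion) with `A(r₀; z), E(r₀; z), D(r₀; z) < ∞`,
then for every `0 < r ≤ r₀` and `0 ≤ λ ≤ ε₀`, `C(r; z) + D(r; z) ≤ λ³` implies `|u| ≤ C₀ λ / r`
a.e. on `Q_{r/2}(z)`. (The paper: "`C(z₀,R) + D(z₀,R) < ε` … `sup_{z ∈ Q(z₀,R/2)} |v(z)| ≤ c₀/R`".)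
[cite: Seregin2020, Prop. 1.4 (1)] -/
theorem exists_epsilonRegularity_top :
    ∃ ε₀ C₀ : ℝ, 0 < ε₀ ∧ 0 < C₀ ∧
      ∀ (Q : Opens (ℝ × EuclideanSpace ℝ (Fin 3)))
        (u : ℝ → EuclideanSpace ℝ (Fin 3) → EuclideanSpace ℝ (Fin 3))
        (p : ℝ → EuclideanSpace ℝ (Fin 3) → ℝ)
        (G : ℝ → EuclideanSpace ℝ (Fin 3) → EuclideanSpace ℝ (Fin 3) →L[ℝ] EuclideanSpace ℝ (Fin 3)),
        IsSuitableWeakSolutionOn Q 1 0 u p → HasWeakSpatialGradientOn Q u G →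
        ∀ (z : ℝ × EuclideanSpace ℝ (Fin 3)) (r₀ : ℝ), 0 < r₀ →
          parabolicCylinder r₀ z ⊆ (Q : Set (ℝ × EuclideanSpace ℝ (Fin 3))) →
          cknAEss r₀ z u ≠ ∞ → cknE r₀ z G ≠ ∞ → cknD r₀ z p ≠ ∞ →
          ∀ (r l : ℝ), 0 < r → r ≤ r₀ → 0 ≤ l → l ≤ ε₀ →
            cknC r z u + cknD r z p ≤ ENNReal.ofReal (l ^ 3) →
            ∀ᵐ w ∂(volume.restrict (parabolicCylinder (r / 2) z)), ‖u w.1 w.2‖ ≤ C₀ * l / r := by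
  obtain ⟨ε₀, C₀, hε₀, hC₀, H⟩ := unforced_epsilonRegularity_of_theorem15_3 RRS2016.theorem15_3_holds
  refine ⟨ε₀, C₀, hε₀, hC₀, fun Q u p G hsw hG z r₀ hr₀ hQ hA₀ hE₀ hD₀ r l hr hrr₀ hl0 hlε hsmall => ?_⟩
  obtain ⟨G', hLR⟩ := exists_isLRSuitableWeakSolutionOn_of_finite hsw hG hr₀ hQ hA₀ hE₀ hD₀ 1
  have hsub : parabolicCylinder r z ⊆
      ((parabolicCylinderOpens r₀ z : Opens (ℝ × EuclideanSpace ℝ (Fin 3))) :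
        Set (ℝ × EuclideanSpace ℝ (Fin 3))) :=
    parabolicCylinder_mono hr.le hrr₀ z
  have hum : AEMeasurable (fun w : ℝ × EuclideanSpace ℝ (Fin 3) => ‖u w.1 w.2‖ₑ ^ (3 : ℕ))
      (volume.restrict (parabolicCylinder r z)) := by
    have h1 : AEStronglyMeasurable (uncurry u) (volume.restrict (parabolicCylinder r z)) :=
      (hG.locallyIntegrableOn.aestronglyMeasurable).mono_measure
        (Measure.restrict_mono (hsub.trans hQ) le_rfl)
    exact h1.enorm.pow_const _
  have hint := setLIntegral_cubic_add_pressure_le_of_cknC_add_cknD_le hr hum hsmall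
  exact H _ 1 u p G' le_rfl hLR z r l hr hsub hl0 hlε hint

/-! ### (2.9): the cubic quantity is bounded below at a singular point with bounded pressure -/

/-- Arithmetic of the constants: if `0 < θ ≤ η / (4 (c+1) (L+1))` and `κ ≤ η θ² / (4 (c+1))`,
then `c θ L + (c + 1) θ⁻¹² κ ≤ η`. [folklore] -/
theorem const_ineq {η c L θ κ : ℝ} (hη : 0 < η) (hc : 0 ≤ c) (hL : 0 ≤ L) (hθ : 0 < θ)
    (hθle : θ ≤ η / (4 * (c + 1) * (L + 1))) (hκ : κ ≤ η * θ ^ 2 / (4 * (c + 1))) :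
    c * θ * L + (c + 1) * θ⁻¹ ^ 2 * κ ≤ η := by
  have h2 : (c + 1) * θ⁻¹ ^ 2 * (η * θ ^ 2 / (4 * (c + 1))) = η / 4 := by
    field_simp
  have h3 : (c + 1) * θ⁻¹ ^ 2 * κ ≤ η / 4 := by
    rw [← h2]
    have : 0 ≤ (c + 1) * θ⁻¹ ^ 2 := by positivity
    exact mul_le_mul_of_nonneg_left hκ this
  have h1 : c * θ * L ≤ η / 4 := by
    have hcL : c * L ≤ (c + 1) * (L + 1) := by nlinarith
    calc c * θ * L = θ * (c * L) := by ring
      _ ≤ η / (4 * (c + 1) * (L + 1)) * ((c + 1) * (L + 1)) := by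
          gcongr
      _ = η / 4 := by field_simp
  linarith

/-- **Seregin 2020, proof of Thm. 2.1, (2.9) (non-triviality at a singular point with bounded
scaled pressure).** For every `L ≥ 0` there is `κ = κ(L) > 0` such that: if `(u, p)` is a suitable
weak solution (`ν = 1`, no force) on an open `Q`, `G` a weak spatial gradient of `u` on `Q`,
`Q_{r₀}(z) ⊆ Q` (open inclusion: `z` may lie on the top of `Q`, as the origin does in Thm. 2.1)
with `A(r₀; z), E(r₀; z) < ∞`, `D(r; z) ≤ L` for all `0 < r ≤ r₀`, and `z` is a backward
singular point of `u`, then `C(r; z) ≥ κ` for all `0 < r ≤ r₀`. (In the paper this is recorded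
for the blow-up limit, "the velocity `u` is not trivial in the sense
`a⁻² ∫_{Q(a)} |u|³ dz ≥ ε(L₀) > 0` for all `0 < a ≤ 1`, see also [Seregin2016]"; by scale
invariance and `le_cknC_of_tendsto_eLpNorm` that statement is this one for the original
solution.) Proof: module docstring. [cite: Seregin2020, proof of Thm. 2.1, (2.9)] -/
theorem exists_le_cknC_of_isBackwardSingularPoint (L : ℝ≥0) :
    ∃ κ : ℝ, 0 < κ ∧
      ∀ (Q : Opens (ℝ × EuclideanSpace ℝ (Fin 3)))
        (u : ℝ → EuclideanSpace ℝ (Fin 3) → EuclideanSpace ℝ (Fin 3))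
        (p : ℝ → EuclideanSpace ℝ (Fin 3) → ℝ)
        (G : ℝ → EuclideanSpace ℝ (Fin 3) → EuclideanSpace ℝ (Fin 3) →L[ℝ] EuclideanSpace ℝ (Fin 3)),
        IsSuitableWeakSolutionOn Q 1 0 u p → HasWeakSpatialGradientOn Q u G →
        ∀ (z : ℝ × EuclideanSpace ℝ (Fin 3)) (r₀ : ℝ), 0 < r₀ →
          parabolicCylinder r₀ z ⊆ (Q : Set (ℝ × EuclideanSpace ℝ (Fin 3))) →
          cknAEss r₀ z u ≠ ∞ → cknE r₀ z G ≠ ∞ →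
          (∀ r ∈ Ioc (0 : ℝ) r₀, cknD r z p ≤ L) →
          IsBackwardSingularPoint u z →
          ∀ r ∈ Ioc (0 : ℝ) r₀, ENNReal.ofReal κ ≤ cknC r z u := by
  obtain ⟨ε₀, C₀, hε₀, hC₀, Hreg⟩ := exists_epsilonRegularity_top
  obtain ⟨c, Hdec⟩ := seregin_sverak_pressure_decay_holds.ratio
  set η : ℝ := ε₀ ^ 3 with hη
  have hηpos : 0 < η := pow_pos hε₀ 3
  set θ : ℝ := min (1 / 2) (η / (4 * ((c : ℝ) + 1) * ((L : ℝ) + 1))) with hθ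
  have hθpos : 0 < θ := lt_min (by norm_num) (by positivity)
  have hθ1 : θ ≤ 1 := (min_le_left _ _).trans (by norm_num)
  set κ : ℝ := η * θ ^ 2 / (4 * ((c : ℝ) + 1)) with hκ
  have hκpos : 0 < κ := by positivity
  refine ⟨κ, hκpos, fun Q u p G hsw hG z r₀ hr₀ hQ hA₀ hE₀ hD hsing r hr => ?_⟩
  by_contra hlt
  rw [not_le] at hlt
  have hr0 : 0 < r := hr.1
  have hrr₀ : r ≤ r₀ := hr.2
  have hθr : 0 < θ * r := mul_pos hθpos hr0
  have hsubr : parabolicCylinder r z ⊆ (Q : Set (ℝ × EuclideanSpace ℝ (Fin 3))) :=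
    (parabolicCylinder_mono hr0.le hrr₀ z).trans hQ
  -- ### the pressure at the scale `θ r`
  have hDθ : cknD (θ * r) z p ≤
      (c : ℝ≥0∞) * (ENNReal.ofReal θ * L + ENNReal.ofReal (θ⁻¹ ^ 2) * ENNReal.ofReal κ) := by
    refine (Hdec Q u p hsw.distributional z r θ hr0 hθpos hθ1 hsubr).trans ?_
    have h1 : cknD r z p ≤ L := hD r hr
    have h2 : cknC r z u ≤ ENNReal.ofReal κ := hlt.le
    gcongr
  -- ### the cubic quantity at the scale `θ r`
  have hCθ : cknC (θ * r) z u ≤ ENNReal.ofReal (θ⁻¹ ^ 2) * ENNReal.ofReal κ := by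
    have hsub : parabolicCylinder (θ * r) z ⊆ parabolicCylinder r z :=
      parabolicCylinder_mono hθr.le (mul_le_of_le_one_left hr0.le hθ1) z
    refine (cknC_le_mul_of_subset hr0 hθr hsub u).trans ?_
    have e : ENNReal.ofReal (r / (θ * r)) ^ 2 = ENNReal.ofReal (θ⁻¹ ^ 2) := by
      rw [← ENNReal.ofReal_pow (by positivity)]
      congr 1
      field_simp
    rw [e]
    gcongr
  -- ### smallness of `C + D` at the scale `θ r`
  have hsmall : cknC (θ * r) z u + cknD (θ * r) z p ≤ ENNReal.ofReal (ε₀ ^ 3) := by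
    have key := const_ineq hηpos c.2 L.2 hθpos (min_le_right _ _) hκ.le
    calc cknC (θ * r) z u + cknD (θ * r) z p
        ≤ ENNReal.ofReal (θ⁻¹ ^ 2) * ENNReal.ofReal κ +
            (c : ℝ≥0∞) * (ENNReal.ofReal θ * L + ENNReal.ofReal (θ⁻¹ ^ 2) * ENNReal.ofReal κ) :=
          add_le_add hCθ hDθ
      _ = ENNReal.ofReal ((c : ℝ) * θ * L + ((c : ℝ) + 1) * θ⁻¹ ^ 2 * κ) := by
          have hc0 : (0 : ℝ) ≤ c := c.2
          have hL0 : (0 : ℝ) ≤ L := L.2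
          have hθi : (0 : ℝ) ≤ θ⁻¹ ^ 2 := by positivity
          rw [← ENNReal.ofReal_coe_nnreal (p := c), ← ENNReal.ofReal_coe_nnreal (p := L),
            ← ENNReal.ofReal_mul hθpos.le, ← ENNReal.ofReal_mul hθi, ← ENNReal.ofReal_add
              (by positivity) (by positivity), ← ENNReal.ofReal_mul hc0, ← ENNReal.ofReal_add
              (by positivity) (by positivity)]
          congr 1
          ring
      _ ≤ ENNReal.ofReal (ε₀ ^ 3) := ENNReal.ofReal_le_ofReal key
  -- ### the ε-regularity criterion at the scale `θ r`
  have hbound := Hreg Q u p G hsw hG z r₀ hr₀ hQ hA₀ hE₀ ?_ (θ * r) ε₀ hθr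
    ((mul_le_of_le_one_left hr0.le hθ1).trans hrr₀) hε₀.le le_rfl hsmall
  · have hfin : eLpNorm (uncurry u) ∞ (volume.restrict (parabolicCylinder (θ * r / 2) z)) < ∞ := by
      rw [eLpNorm_exponent_top]
      exact eLpNormEssSup_lt_top_of_ae_bound hbound
    exact hfin.ne (hsing (θ * r / 2) (by positivity))
  · -- `D(r₀) < ∞`
    exact ne_top_of_le_ne_top ENNReal.coe_ne_top (hD r₀ ⟨hr₀, le_rfl⟩)

/-! ### Lower bounds of `C` pass to strong `L³` limits -/

/-- **Lower bounds of `C(Q(z,r))` pass to strong `L³` limits** (the twin of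
`cknC_le_of_tendsto_eLpNorm`). If `v_k → u` in `L³(Q₀)`, `Q(z, r) ⊆ Q₀`, `r > 0`, and
`κ ≤ C(Q(z,r); v_k)` for all `k`, then `κ ≤ C(Q(z,r); u)` (Minkowski:
`‖v_k‖_{L³(Q(z,r))} ≤ ‖u‖_{L³} + ‖v_k - u‖_{L³}`). This carries the non-triviality bound (2.9) from the
rescaled solutions `uᵏ` to their limit in the proof of Thm. 2.1. [cite: Seregin2020, proof of Thm. 2.1, (2.9)] -/
theorem le_cknC_of_tendsto_eLpNorm {Q₀ : Set (ℝ × EuclideanSpace ℝ (Fin 3))} {r : ℝ}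
    {z : ℝ × EuclideanSpace ℝ (Fin 3)}
    {v : ℕ → ℝ → EuclideanSpace ℝ (Fin 3) → EuclideanSpace ℝ (Fin 3)}
    {u : ℝ → EuclideanSpace ℝ (Fin 3) → EuclideanSpace ℝ (Fin 3)} {κ : ℝ≥0∞}
    (hr : 0 < r) (hQ : parabolicCylinder r z ⊆ Q₀)
    (hv : ∀ k, AEStronglyMeasurable (uncurry (v k)) (volume.restrict Q₀))
    (hu : AEStronglyMeasurable (uncurry u) (volume.restrict Q₀))
    (hconv : Tendsto (fun k => eLpNorm (uncurry (v k) - uncurry u) 3 (volume.restrict Q₀))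
      atTop (𝓝 0))
    (hbound : ∀ k, κ ≤ cknC r z (v k)) : κ ≤ cknC r z u := by
  set Q' := parabolicCylinder r z with hQ'
  set μ' : Measure (ℝ × EuclideanSpace ℝ (Fin 3)) := volume.restrict Q' with hμ'
  have hμle : μ' ≤ volume.restrict Q₀ := Measure.restrict_mono hQ le_rfl
  have hr2 : (ENNReal.ofReal r ^ 2) ≠ 0 := pow_ne_zero _ ((ENNReal.ofReal_pos.2 hr).ne')
  have hr2' : (ENNReal.ofReal r ^ 2) ≠ ∞ := ENNReal.pow_ne_top ENNReal.ofReal_ne_top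
  -- the cubes as real powers
  have hcube : ∀ f : ℝ → EuclideanSpace ℝ (Fin 3) → EuclideanSpace ℝ (Fin 3),
      ∫⁻ q in Q', ‖f q.1 q.2‖ₑ ^ (3 : ℕ) = ∫⁻ q, ‖uncurry f q‖ₑ ^ (3 : ℝ) ∂μ' := by
    intro f
    refine lintegral_congr fun q => ?_
    show ‖uncurry f q‖ₑ ^ (3 : ℕ) = ‖uncurry f q‖ₑ ^ (3 : ℝ)
    rw [← ENNReal.rpow_natCast]
    norm_num
  -- lower bound on the approximants: `r² κ ≤ ∫ |v_k|³`
  have hvk : ∀ k, (ENNReal.ofReal r ^ 2 * κ) ^ (1 / (3 : ℝ)) ≤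
      (∫⁻ q, ‖uncurry (v k) q‖ₑ ^ (3 : ℝ) ∂μ') ^ (1 / (3 : ℝ)) := by
    intro k
    refine ENNReal.rpow_le_rpow ?_ (by norm_num)
    rw [← hcube]
    exact (ENNReal.mul_le_iff_le_inv hr2 hr2').2 (hbound k)
  -- the error terms `ε_k = ‖v_k - u‖_{L³(Q')} → 0`
  set ε : ℕ → ℝ≥0∞ := fun k => (∫⁻ q, ‖(uncurry (v k) - uncurry u) q‖ₑ ^ (3 : ℝ) ∂μ') ^
    (1 / (3 : ℝ)) with hε
  have hε' : ∀ k, ε k = eLpNorm (uncurry (v k) - uncurry u) 3 μ' := by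
    intro k
    rw [hε, eLpNorm_eq_lintegral_rpow_enorm_toReal (by norm_num) (by norm_num)]
    norm_num
  have hεlim : Tendsto ε atTop (𝓝 0) := by
    refine tendsto_of_tendsto_of_tendsto_of_le_of_le tendsto_const_nhds hconv
      (fun k => bot_le) fun k => ?_
    rw [hε']
    exact eLpNorm_mono_measure _ hμle
  -- Minkowski: `‖v_k‖₃ ≤ ‖u‖₃ + ε_k`
  set X := (∫⁻ q, ‖uncurry u q‖ₑ ^ (3 : ℝ) ∂μ') ^ (1 / (3 : ℝ)) with hX
  have hXle : ∀ k, (ENNReal.ofReal r ^ 2 * κ) ^ (1 / (3 : ℝ)) ≤ X + ε k := by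
    intro k
    have hfm : AEMeasurable (fun q => ‖uncurry u q‖ₑ) μ' := (hu.mono_measure hμle).enorm
    have hgm : AEMeasurable (fun q => ‖(uncurry (v k) - uncurry u) q‖ₑ) μ' :=
      (((hv k).sub hu).mono_measure hμle).enorm
    have h1 : (∫⁻ q, ‖uncurry (v k) q‖ₑ ^ (3 : ℝ) ∂μ') ^ (1 / (3 : ℝ)) ≤
        (∫⁻ q, ((fun q => ‖uncurry u q‖ₑ) + fun q => ‖(uncurry (v k) - uncurry u) q‖ₑ)
          q ^ (3 : ℝ) ∂μ') ^ (1 / (3 : ℝ)) := by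
      refine ENNReal.rpow_le_rpow (lintegral_mono fun q => ?_) (by norm_num)
      refine ENNReal.rpow_le_rpow ?_ (by norm_num)
      simp only [Pi.add_apply, Pi.sub_apply]
      calc ‖uncurry (v k) q‖ₑ = ‖uncurry u q + (uncurry (v k) q - uncurry u q)‖ₑ := by
            rw [add_sub_cancel]
        _ ≤ ‖uncurry u q‖ₑ + ‖uncurry (v k) q - uncurry u q‖ₑ := enorm_add_le _ _
    refine (hvk k).trans (h1.trans ?_)
    exact ENNReal.lintegral_Lp_add_le hfm hgm (by norm_num)
  have hXle' : (ENNReal.ofReal r ^ 2 * κ) ^ (1 / (3 : ℝ)) ≤ X := by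
    have ht : Tendsto (fun k => X + ε k) atTop (𝓝 X) := by
      have := (tendsto_const_nhds (x := X) (f := (atTop : Filter ℕ))).add hεlim
      rwa [add_zero] at this
    exact ge_of_tendsto' ht hXle
  -- cube and divide by `r²`
  have hX3 : ENNReal.ofReal r ^ 2 * κ ≤ ∫⁻ q, ‖uncurry u q‖ₑ ^ (3 : ℝ) ∂μ' := by
    have := ENNReal.rpow_le_rpow hXle' (by norm_num : (0 : ℝ) ≤ 3)
    rwa [hX, ← ENNReal.rpow_mul, ← ENNReal.rpow_mul, show (1 / (3 : ℝ)) * 3 = 1 by norm_num,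
      ENNReal.rpow_one, ENNReal.rpow_one] at this
  rw [cknC, hcube]
  exact (ENNReal.mul_le_iff_le_inv hr2 hr2').1 hX3

/-! ### (2.8)–(2.9) in the setting of Theorem 2.1 -/

/-- **Seregin 2020, proof of Thm. 2.1, (2.8)–(2.9) for the original solution.** Under the
hypotheses of Theorem 2.1 except axial symmetry (a suitable weak solution `(u, p)` of the unforced
Navier–Stokes equations in `Q = 𝒞 × ]-1, 0[` with the global classes of Def. 1.3 and a weak
spatial gradient `G`, the origin a backward singular point) and the Type I assumption
`g(0) < ∞` ((2.7)), there are `K < ∞`, `κ > 0` and `r₁ > 0` with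
`A(r) + E(r) + C(r) + D(r) ≤ K` ((2.8), `typeI_scaledEnergies_bounded`) and `C(r) ≥ κ` ((2.9),
`exists_le_cknC_of_isBackwardSingularPoint`) for all `0 < r ≤ r₁` — the two quantitative facts
about `v` that the rescaled solutions `uᵏ(y,s) = λₖ v(λₖ y, λₖ² s)` inherit at every scale
(`A(uᵏ; a) = A(v; λₖ a)` etc.). [cite: Seregin2020, proof of Thm. 2.1, (2.8)–(2.9)] -/
theorem typeI_singular_scaledEnergies
    {u : ℝ → EuclideanSpace ℝ (Fin 3) → EuclideanSpace ℝ (Fin 3)}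
    {p : ℝ → EuclideanSpace ℝ (Fin 3) → ℝ}
    {G : ℝ → EuclideanSpace ℝ (Fin 3) → EuclideanSpace ℝ (Fin 3) →L[ℝ] EuclideanSpace ℝ (Fin 3)}
    (hsw : IsSuitableWeakSolutionOn (SereginSverak2009.parCylOpens 0 1) 1 0 u p)
    (hA : ∃ C : ℝ≥0, ∀ᵐ t ∂(volume.restrict (Ioo (-1 : ℝ) 0)),
      ∫⁻ x in SereginSverak2009.spaceCyl 0 1, ‖u t x‖ₑ ^ 2 ≤ C)
    (hG : HasWeakSpatialGradientOn (SereginSverak2009.parCylOpens 0 1) u G)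
    (hE : ∫⁻ z in SereginSverak2009.parCyl 0 1, ENNReal.ofReal (frobeniusNormSq (G z.1 z.2)) < ∞)
    (hp : ∫⁻ z in SereginSverak2009.parCyl 0 1, ‖p z.1 z.2‖ₑ ^ (3 / 2 : ℝ) < ∞)
    (hsing : IsBackwardSingularPoint u 0) (hI : blowupIndex 0 u G < ∞) :
    ∃ K : ℝ≥0, ∃ κ : ℝ, 0 < κ ∧ ∃ r₁ : ℝ, 0 < r₁ ∧ r₁ ≤ 1 ∧ ∀ r ∈ Ioc (0 : ℝ) r₁,
      cknAEss r (0 : ℝ × EuclideanSpace ℝ (Fin 3)) u + cknE r (0 : ℝ × EuclideanSpace ℝ (Fin 3)) G +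
          cknC r (0 : ℝ × EuclideanSpace ℝ (Fin 3)) u + cknD r (0 : ℝ × EuclideanSpace ℝ (Fin 3)) p ≤ K ∧
        ENNReal.ofReal κ ≤ cknC r (0 : ℝ × EuclideanSpace ℝ (Fin 3)) u := by
  obtain ⟨K, r₁, hr₁, hK⟩ := typeI_scaledEnergies_bounded hsw hA hG hE hp hI
  obtain ⟨κ, hκ, H⟩ := exists_le_cknC_of_isBackwardSingularPoint K
  set r₂ : ℝ := min r₁ 1 with hr₂
  have hr₂pos : 0 < r₂ := lt_min hr₁ one_pos
  have hr₂1 : r₂ ≤ 1 := min_le_right _ _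
  have hr₂r₁ : r₂ ≤ r₁ := min_le_left _ _
  have hQ : parabolicCylinder r₂ (0 : ℝ × EuclideanSpace ℝ (Fin 3)) ⊆
      ((SereginSverak2009.parCylOpens 0 1 : Opens (ℝ × EuclideanSpace ℝ (Fin 3))) :
        Set (ℝ × EuclideanSpace ℝ (Fin 3))) := by
    rw [SereginSverak2009.coe_parCylOpens]
    exact (parabolicCylinder_mono hr₂pos.le hr₂1 _).trans (parabolicCylinder_subset_parCyl 0 1)
  have hKr₂ := hK r₂ ⟨hr₂pos, hr₂r₁⟩
  have hKtop : cknAEss r₂ (0 : ℝ × EuclideanSpace ℝ (Fin 3)) u + cknE r₂ (0 : ℝ × EuclideanSpace ℝ (Fin 3)) G +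
      cknC r₂ (0 : ℝ × EuclideanSpace ℝ (Fin 3)) u + cknD r₂ (0 : ℝ × EuclideanSpace ℝ (Fin 3)) p ≠ ∞ :=
    ne_top_of_le_ne_top ENNReal.coe_ne_top hKr₂
  have hA₀ : cknAEss r₂ (0 : ℝ × EuclideanSpace ℝ (Fin 3)) u ≠ ∞ :=
    ne_top_of_le_ne_top hKtop (le_self_add.trans (le_self_add.trans le_self_add))
  have hE₀ : cknE r₂ (0 : ℝ × EuclideanSpace ℝ (Fin 3)) G ≠ ∞ :=
    ne_top_of_le_ne_top hKtop (le_add_self.trans (le_self_add.trans le_self_add))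
  have hD : ∀ r ∈ Ioc (0 : ℝ) r₂, cknD r (0 : ℝ × EuclideanSpace ℝ (Fin 3)) p ≤ K := fun r hr =>
    le_add_self.trans (hK r ⟨hr.1, hr.2.trans hr₂r₁⟩)
  refine ⟨K, κ, hκ, r₂, hr₂pos, hr₂1, fun r hr => ⟨hK r ⟨hr.1, hr.2.trans hr₂r₁⟩, ?_⟩⟩
  exact H _ u p G hsw hG 0 r₂ hr₂pos hQ hA₀ hE₀ hD hsing r hr

end Seregin2020

end Literature.Analysis.FluidPDE

end
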